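import Mathlib
import Summits.Ventures.PercRepro2.Defs
import Summits.Ventures.PercRepro2.Harris

/-!
# The (CR) inequality for a principal down-set: `R = {all edges of F closed}`
(blind cell PercRepro2, mine-a g39; MINE-A.md §94.0)

For admissible weights `p`, up-sets `U, e` of the configuration and a finite set of edges `F`,
with `R := allClosed F = {ω ∣ ∀ g ∈ F, ω g = false}`,

  `P(R) · P(U) · P(e) ≤ P(R) · P(Rᶜ ∩ U ∩ e) + P(R ∩ U) · P(R ∩ e)`,

i.e. `Cov(U, e) ≥ P(R) · Cov(U, e ∣ R)`: the (CR) form of MINE-A.md §93.9 (`CRForms.lean`) with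
the avoidance event `{s ↮ X}` replaced by the PRINCIPAL down-set `{F closed}`.  This is the
product-measure instance of §94.0 (every log-supermodular law, every principal down-set), proved
here by induction on `F`: pinning one edge `g ∈ F` (`prob_eq_pin`), the `g`-open world has
`R = ∅` and contributes `Cov ≥ 0` (Harris), the `g`-closed world is the induction hypothesis, and
the cross term is `t(1 − t) · ΔU · Δe ≥ 0` (`prob_update_zero_le_prob_update_one`).  Exactly:

  `RHS − LHS = (1 − t)² · s₀ + (1 − t) t · P₀(R) · Cov₁(U, e) + (1 − t)² t · P₀(R) · ΔU · Δe`.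

The percolation candidate (CR) itself is the same inequality for the NON-principal down-set
`avoidAll ends s X`; nothing about it is claimed here.  No definition; one seat.
-/

namespace Summit.Ventures.PercRepro2

namespace CRPrincipal

variable {E : Type*} [Fintype E] [DecidableEq E] {R : Type*} [CommRing R] [LinearOrder R]
  [IsStrictOrderedRing R]

/-- Pinning an edge open raises the probability of an increasing event. -/
lemma prob_update_zero_le_prob_update_one {p : E → R} (hp : IsProbVec p) {A : Set (Config E)}
    (hA : IsUpperSet A) (g : E) :
    prob (Function.update p g 0) A ≤ prob (Function.update p g 1) A := by
  simp only [prob_eq_expect_indicator]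
  exact expect_update_zero_le_expect_update_one hp (monotone_indicator_of_isUpperSet (R := R) hA) g

omit [Fintype E] in
/-- `allClosed (insert g F) = allClosed F ∩ closedEdge g`. -/
lemma allClosed_insert (F : Finset E) (g : E) :
    allClosed (insert g F) = allClosed F ∩ closedEdge g := by
  ext ω
  simp only [mem_allClosed, Finset.mem_insert, Set.mem_inter_iff, mem_closedEdge]
  constructor
  · intro h
    exact ⟨fun e he => h e (Or.inr he), h g (Or.inl rfl)⟩
  · rintro ⟨h1, h2⟩ e he
    rcases he with rfl | he
    · exact h2
    · exact h1 e he

omit [Fintype E] [DecidableEq E] in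
/-- `allClosed ∅ = univ`. -/
lemma allClosed_empty : allClosed (∅ : Finset E) = Set.univ := by
  ext ω; simp [mem_allClosed]

omit [Fintype E] [DecidableEq E] in
/-- On `{g open}` the complement of `allClosed F ∩ closedEdge g` is everything. -/
lemma compl_inter_inter_openEdge (F : Finset E) (g : E) (A B : Set (Config E)) :
    (allClosed F ∩ closedEdge g)ᶜ ∩ A ∩ B ∩ openEdge g = A ∩ B ∩ openEdge g := by
  ext ω
  simp only [Set.mem_inter_iff, Set.mem_compl_iff, mem_closedEdge, mem_openEdge]
  constructor
  · rintro ⟨⟨⟨_, hA⟩, hB⟩, hg⟩; exact ⟨⟨hA, hB⟩, hg⟩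
  · rintro ⟨⟨hA, hB⟩, hg⟩
    refine ⟨⟨⟨fun h => ?_, hA⟩, hB⟩, hg⟩
    rw [h.2] at hg
    exact Bool.false_ne_true hg

omit [Fintype E] [DecidableEq E] in
/-- On `{g closed}` the complement of `allClosed F ∩ closedEdge g` is the complement of
`allClosed F`. -/
lemma compl_inter_inter_closedEdge (F : Finset E) (g : E) (A B : Set (Config E)) :
    (allClosed F ∩ closedEdge g)ᶜ ∩ A ∩ B ∩ closedEdge g =
      (allClosed F)ᶜ ∩ A ∩ B ∩ closedEdge g := by
  ext ω
  simp only [Set.mem_inter_iff, Set.mem_compl_iff, mem_closedEdge]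
  constructor
  · rintro ⟨⟨⟨h, hA⟩, hB⟩, hg⟩
    exact ⟨⟨⟨fun hR => h ⟨hR, hg⟩, hA⟩, hB⟩, hg⟩
  · rintro ⟨⟨⟨h, hA⟩, hB⟩, hg⟩
    exact ⟨⟨⟨fun hR => h hR.1, hA⟩, hB⟩, hg⟩

omit [LinearOrder R] [IsStrictOrderedRing R] in
/-- The `R ∩ A` masses of the step: `P(R ∩ {g closed} ∩ A) = (1 − p g) · P_{p[g↦0]}(R ∩ A)`. -/
lemma prob_inter_closedEdge_inter (p : E → R) (F : Finset E) (g : E) (A : Set (Config E)) :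
    prob p (allClosed F ∩ closedEdge g ∩ A) =
      (1 - p g) * prob (Function.update p g 0) (allClosed F ∩ A) := by
  have : allClosed F ∩ closedEdge g ∩ A = (allClosed F ∩ A) ∩ closedEdge g := by
    ext ω; simp only [Set.mem_inter_iff]; tauto
  rw [this, prob_inter_closedEdge]

omit [LinearOrder R] [IsStrictOrderedRing R] in
/-- The `Rᶜ ∩ U ∩ e` mass of the step. -/
lemma prob_compl_inter_pin (p : E → R) (F : Finset E) (g : E) (U e : Set (Config E)) :
    prob p ((allClosed F ∩ closedEdge g)ᶜ ∩ U ∩ e) =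
      p g * prob (Function.update p g 1) (U ∩ e) +
        (1 - p g) * prob (Function.update p g 0) ((allClosed F)ᶜ ∩ U ∩ e) := by
  rw [prob_eq_pin p _ g]
  congr 1
  · congr 1
    calc prob (Function.update p g 1) ((allClosed F ∩ closedEdge g)ᶜ ∩ U ∩ e)
        = prob (Function.update p g 1) ((allClosed F ∩ closedEdge g)ᶜ ∩ U ∩ e ∩ openEdge g) :=
          (prob_update_one_inter_openEdge p _ g).symm
      _ = prob (Function.update p g 1) (U ∩ e ∩ openEdge g) := by
          rw [compl_inter_inter_openEdge]
      _ = prob (Function.update p g 1) (U ∩ e) := prob_update_one_inter_openEdge p _ g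
  · congr 1
    calc prob (Function.update p g 0) ((allClosed F ∩ closedEdge g)ᶜ ∩ U ∩ e)
        = prob (Function.update p g 0) ((allClosed F ∩ closedEdge g)ᶜ ∩ U ∩ e ∩ closedEdge g) :=
          (prob_update_zero_inter_closedEdge p _ g).symm
      _ = prob (Function.update p g 0) ((allClosed F)ᶜ ∩ U ∩ e ∩ closedEdge g) := by
          rw [compl_inter_inter_closedEdge]
      _ = prob (Function.update p g 0) ((allClosed F)ᶜ ∩ U ∩ e) :=
          prob_update_zero_inter_closedEdge p _ g

/-- **(CR) for a principal down-set.** For admissible `p`, a finite set of edges `F` with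
`R = allClosed F`, and up-sets `U, e`:
`P(R) P(U) P(e) ≤ P(R) P(Rᶜ ∩ U ∩ e) + P(R ∩ U) P(R ∩ e)`. -/
theorem cr_allClosed (F : Finset E) :
    ∀ (p : E → R), IsProbVec p → ∀ {U e : Set (Config E)}, IsUpperSet U → IsUpperSet e →
      prob p (allClosed F) * prob p U * prob p e ≤
        prob p (allClosed F) * prob p ((allClosed F)ᶜ ∩ U ∩ e) +
          prob p (allClosed F ∩ U) * prob p (allClosed F ∩ e) := by
  classical
  induction F using Finset.induction_on with
  | empty =>
    intro p _ U e _ _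
    simp only [allClosed_empty, prob_univ, Set.compl_univ, Set.empty_inter, prob_empty,
      Set.univ_inter, one_mul, mul_zero, zero_add]
    exact le_refl _
  | insert g F hg ih =>
    intro p hp U e hU he
    rw [allClosed_insert]
    have h1 : prob p (allClosed F ∩ closedEdge g) =
        (1 - p g) * prob (Function.update p g 0) (allClosed F) :=
      prob_inter_closedEdge p (allClosed F) g
    rw [h1, prob_inter_closedEdge_inter, prob_inter_closedEdge_inter, prob_compl_inter_pin,
      prob_eq_pin p U g, prob_eq_pin p e g]
    have hp0 : IsProbVec (Function.update p g 0) := hp.update g le_rfl zero_le_one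
    have hp1 : IsProbVec (Function.update p g 1) := hp.update g zero_le_one le_rfl
    have hIH := ih (Function.update p g 0) hp0 hU he
    have hHarris := prob_mul_prob_le_prob_inter hp1 hU he
    have hmU := prob_update_zero_le_prob_update_one hp hU g
    have hme := prob_update_zero_le_prob_update_one hp he g
    have ht0 : 0 ≤ p g := hp.nonneg g
    have ht1 : 0 ≤ 1 - p g := sub_nonneg.2 (hp.le_one g)
    have ha : 0 ≤ prob (Function.update p g 0) (allClosed F) := prob_nonneg hp0 _
    set t := p g with ht
    set a := prob (Function.update p g 0) (allClosed F) with ha'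
    set u0 := prob (Function.update p g 0) U
    set u1 := prob (Function.update p g 1) U
    set e0 := prob (Function.update p g 0) e
    set e1 := prob (Function.update p g 1) e
    set c := prob (Function.update p g 1) (U ∩ e)
    set q := prob (Function.update p g 0) ((allClosed F)ᶜ ∩ U ∩ e)
    set b := prob (Function.update p g 0) (allClosed F ∩ U)
    set d := prob (Function.update p g 0) (allClosed F ∩ e)
    have key :
        (1 - t) * a * (t * c + (1 - t) * q) + (1 - t) * b * ((1 - t) * d) -
          (1 - t) * a * (t * u1 + (1 - t) * u0) * (t * e1 + (1 - t) * e0) =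
        (1 - t) ^ 2 * (a * q + b * d - a * u0 * e0) + (1 - t) * t * a * (c - u1 * e1) +
          (1 - t) ^ 2 * t * a * ((u1 - u0) * (e1 - e0)) := by ring
    have hS0 : 0 ≤ a * q + b * d - a * u0 * e0 := by linarith [hIH]
    have hC : 0 ≤ c - u1 * e1 := by linarith [hHarris]
    have hD : 0 ≤ (u1 - u0) * (e1 - e0) := mul_nonneg (by linarith) (by linarith)
    have hT1 : 0 ≤ (1 - t) ^ 2 * (a * q + b * d - a * u0 * e0) := mul_nonneg (by positivity) hS0
    have hT2 : 0 ≤ (1 - t) * t * a * (c - u1 * e1) :=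
      mul_nonneg (mul_nonneg (mul_nonneg ht1 ht0) ha) hC
    have hT3 : 0 ≤ (1 - t) ^ 2 * t * a * ((u1 - u0) * (e1 - e0)) :=
      mul_nonneg (mul_nonneg (mul_nonneg (by positivity) ht0) ha) hD
    nlinarith [key, hT1, hT2, hT3]

end CRPrincipal

end Summit.Ventures.PercRepro2
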